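import Literature.NumberTheory.Sieve.MoebiusShiftedPrimesProofs
import HarnessLib

/-!
# Sums of greatest common divisors along an interval (Matomäki–Merikoski, Lemma 3.7)

Topic `Literature/NumberTheory/LFunctions`, sub-namespace `MatomakiMerikoski`. Lemma 3.7 of
K. Matomäki, J. Merikoski, *Siegel zeros, twin primes, Goldbach's conjecture, and primes in short
intervals* (IMRN 2023; arXiv:2112.11412), §3.5 ("We also need the following rough bounds"), used
in the proofs of their Lemma 3.8 (incomplete Kloosterman sums) and Proposition 2.3 (§5):
"Let `L ≥ 1`. For any integer `q ≠ 0` we have `∑_{1 ≤ ℓ ≤ L} (ℓ, q) ≤ τ(q) L` and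
`∑_{1 ≤ ℓ ≤ L} (ℓ, q) ℓ/φ(ℓ) ≪ τ(q)² L`." Everything here is PROVED (theorems only), with the
explicit constant `e` in the second bound:

* `gcd_le_sum_divisors_filter_dvd` — `(ℓ, q) ≤ ∑_{e ∣ q, e ∣ ℓ} e` (the gcd is one of the terms);
* `MatomakiMerikoski2023_lemma37_i` — `∑_{1 ≤ ℓ ≤ L} (ℓ, q) ≤ τ(q) L` (`q ≥ 1`; proof as printed:
  "`≤ ∑_{d ∣ q} d ∑_{1 ≤ k ≤ L/d} 1 ≤ L ∑_{d ∣ q} 1 = τ(q)L`"), and `…_lemma37_i_int` for an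
  integer `q ≠ 0` (`(ℓ, q) = (ℓ, |q|)`, `τ(q) = τ(|q|)`);
* `self_div_totient_le_card_divisors'` — `m/φ(m) = ∏_{p ∣ m} p/(p − 1) ≤ 2^{ω(m)} ≤ τ(m)`;
* `MatomakiMerikoski2023_lemma37_ii` — `∑_{1 ≤ ℓ ≤ L} (ℓ, q) ℓ/φ(ℓ) ≤ e τ(q)² L` (`q ≥ 1`; as
  printed: "using also `φ(dk) ≥ φ(d)φ(k)` and `∑_{k ≤ K} k/φ(k) ≪ K` we get
  `≤ ∑_{d ∣ q} (d²/φ(d)) ∑_{k ≤ L/d} k/φ(k) ≪ ∑_{d ∣ q} Ld/φ(d) … ≤ τ(q)² L`", with the tree's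
  `Lichtman2020.sum_div_totient_le`: `∑_{k ≤ K} k/φ(k) ≤ eK`, and `d/φ(d) ≤ τ(d) ≤ τ(q)`).

## References

* K. Matomäki, J. Merikoski, IMRN 2023:23, 20337–20384 (arXiv:2112.11412), §3.5, Lemma 3.7 and
  its proof. [cite: MatomakiMerikoski2023, Lemma 3.7]
-/

noncomputable section

open Finset Real

namespace Literature.NumberTheory.LFunctions.MatomakiMerikoski

open Literature.NumberTheory.Sieve.Lichtman2020 (sum_div_totient_le)

/-! ### The first bound -/

/-- `(ℓ, q) ≤ ∑_{e ∣ q, e ∣ ℓ} e` for `q ≥ 1`: the gcd is one of the (non-negative) terms.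
[folklore] -/
theorem gcd_le_sum_divisors_filter_dvd {q : ℕ} (hq : q ≠ 0) (ℓ : ℕ) :
    (Nat.gcd ℓ q : ℝ) ≤ ∑ e ∈ q.divisors.filter (· ∣ ℓ), (e : ℝ) := by
  have hmem : Nat.gcd ℓ q ∈ q.divisors.filter (· ∣ ℓ) :=
    mem_filter.mpr ⟨Nat.mem_divisors.mpr ⟨Nat.gcd_dvd_right ℓ q, hq⟩, Nat.gcd_dvd_left ℓ q⟩
  exact single_le_sum (f := fun e : ℕ => (e : ℝ)) (fun e _ => Nat.cast_nonneg e) hmem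

/-- **Matomäki–Merikoski 2023, Lemma 3.7, first bound**: `∑_{1 ≤ ℓ ≤ L} (ℓ, q) ≤ τ(q) L` for
`q ≥ 1` ("Writing `d = (ℓ, q)` and `ℓ = kd`, we have
`∑_{1 ≤ ℓ ≤ L} (ℓ, q) ≤ ∑_{d ∣ q} d ∑_{1 ≤ k ≤ L/d} 1 ≤ L ∑_{d ∣ q} 1 = τ(q)L`").
[cite: MatomakiMerikoski2023, Lemma 3.7] -/
theorem MatomakiMerikoski2023_lemma37_i {q : ℕ} (hq : q ≠ 0) (L : ℕ) :
    ∑ ℓ ∈ Icc 1 L, (Nat.gcd ℓ q : ℝ) ≤ #q.divisors * L := by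
  calc ∑ ℓ ∈ Icc 1 L, (Nat.gcd ℓ q : ℝ)
      ≤ ∑ ℓ ∈ Icc 1 L, ∑ e ∈ q.divisors.filter (· ∣ ℓ), (e : ℝ) :=
        sum_le_sum fun ℓ _ => gcd_le_sum_divisors_filter_dvd hq ℓ
    _ = ∑ ℓ ∈ Icc 1 L, ∑ e ∈ q.divisors, if e ∣ ℓ then (e : ℝ) else 0 :=
        sum_congr rfl fun ℓ _ => sum_filter _ _
    _ = ∑ e ∈ q.divisors, ∑ ℓ ∈ Icc 1 L, if e ∣ ℓ then (e : ℝ) else 0 := sum_comm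
    _ = ∑ e ∈ q.divisors, (e : ℝ) * #((Icc 1 L).filter (e ∣ ·)) := by
        refine sum_congr rfl fun e _ => ?_
        rw [← sum_filter, sum_const, nsmul_eq_mul, mul_comm]
    _ = ∑ e ∈ q.divisors, (e : ℝ) * ((L / e : ℕ) : ℝ) := by
        refine sum_congr rfl fun e _ => ?_
        rw [show Icc 1 L = Ioc 0 L from rfl, Nat.Ioc_filter_dvd_card_eq_div]
    _ ≤ ∑ _e ∈ q.divisors, (L : ℝ) := by
        refine sum_le_sum fun e he => ?_
        have he0 : 0 < e := Nat.pos_of_mem_divisors he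
        have h1 : e * (L / e) ≤ L := Nat.mul_div_le L e
        exact_mod_cast h1
    _ = #q.divisors * L := by rw [sum_const, nsmul_eq_mul]

/-- The first bound for an integer `q ≠ 0` ("For any integer `q ≠ 0`"): `(ℓ, q) = (ℓ, |q|)` and
`τ(q) = τ(|q|)`. [cite: MatomakiMerikoski2023, Lemma 3.7] -/
theorem MatomakiMerikoski2023_lemma37_i_int {q : ℤ} (hq : q ≠ 0) (L : ℕ) :
    ∑ ℓ ∈ Icc 1 L, (Int.gcd (ℓ : ℤ) q : ℝ) ≤ #q.natAbs.divisors * L := by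
  have h := MatomakiMerikoski2023_lemma37_i (Int.natAbs_ne_zero.mpr hq) L
  refine le_trans (le_of_eq (sum_congr rfl fun ℓ _ => ?_)) h
  congr 1

/-! ### `m/φ(m) ≤ τ(m)` -/

/-- `m/φ(m) = ∏_{p ∣ m} p/(p − 1) ≤ 2^{ω(m)} ≤ τ(m)` for `m ≥ 1`. [folklore] -/
theorem self_div_totient_le_card_divisors' {m : ℕ} (hm : m ≠ 0) :
    (m : ℝ) / (Nat.totient m : ℝ) ≤ (#m.divisors : ℝ) := by
  have hφ : 0 < Nat.totient m := Nat.totient_pos.mpr (Nat.pos_of_ne_zero hm)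
  have hφr : (0 : ℝ) < Nat.totient m := by exact_mod_cast hφ
  -- `φ(m) ∏ p = m ∏ (p - 1)` and `∏ p ≤ 2^ω ∏ (p - 1)`, `2^ω ≤ τ(m)`
  have hid := Nat.totient_mul_prod_primeFactors m
  have hprod : ∏ p ∈ m.primeFactors, (p : ℝ) ≤ 2 ^ #m.primeFactors * ∏ p ∈ m.primeFactors, ((p - 1 : ℕ) : ℝ) := by
    rw [← prod_const, ← prod_mul_distrib]
    refine prod_le_prod (fun p _ => Nat.cast_nonneg p) fun p hp => ?_
    have h2 := (Nat.prime_of_mem_primeFactors hp).two_le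
    have : ((p - 1 : ℕ) : ℝ) = (p : ℝ) - 1 := by
      rw [Nat.cast_sub (by omega)]; simp
    rw [this]
    have : (2 : ℝ) ≤ p := by exact_mod_cast h2
    linarith
  have htau : (2 : ℝ) ^ #m.primeFactors ≤ #m.divisors := by
    rw [Nat.card_divisors hm, ← prod_const]
    push_cast
    refine prod_le_prod (fun _ _ => by norm_num) fun p hp => ?_
    have : 1 ≤ m.factorization p :=
      Nat.Prime.factorization_pos_of_dvd (Nat.prime_of_mem_primeFactors hp) hm
        (Nat.dvd_of_mem_primeFactors hp)
    have : (1 : ℝ) ≤ m.factorization p := by exact_mod_cast this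
    linarith
  have hP0 : 0 < ∏ p ∈ m.primeFactors, ((p - 1 : ℕ) : ℝ) := by
    refine prod_pos fun p hp => ?_
    have h2 := (Nat.prime_of_mem_primeFactors hp).two_le
    exact_mod_cast (show 0 < p - 1 by omega)
  rw [div_le_iff₀ hφr]
  -- multiply the identity by `∏ (p-1)`-positivity bookkeeping
  have hidr : (Nat.totient m : ℝ) * ∏ p ∈ m.primeFactors, (p : ℝ) =
      (m : ℝ) * ∏ p ∈ m.primeFactors, ((p - 1 : ℕ) : ℝ) := by
    have h := congrArg (fun n : ℕ => (n : ℝ)) hid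
    push_cast at h
    exact h
  -- `m ∏(p-1) = φ ∏ p ≤ φ 2^ω ∏(p-1) ≤ φ τ ∏(p-1)`
  have h1 : (m : ℝ) * ∏ p ∈ m.primeFactors, ((p - 1 : ℕ) : ℝ) ≤
      (#m.divisors : ℝ) * (Nat.totient m : ℝ) * ∏ p ∈ m.primeFactors, ((p - 1 : ℕ) : ℝ) := by
    calc (m : ℝ) * ∏ p ∈ m.primeFactors, ((p - 1 : ℕ) : ℝ)
        = (Nat.totient m : ℝ) * ∏ p ∈ m.primeFactors, (p : ℝ) := hidr.symm
      _ ≤ (Nat.totient m : ℝ) * (2 ^ #m.primeFactors * ∏ p ∈ m.primeFactors, ((p - 1 : ℕ) : ℝ)) :=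
          mul_le_mul_of_nonneg_left hprod hφr.le
      _ ≤ (Nat.totient m : ℝ) * ((#m.divisors : ℝ) * ∏ p ∈ m.primeFactors, ((p - 1 : ℕ) : ℝ)) := by
          gcongr
      _ = (#m.divisors : ℝ) * (Nat.totient m : ℝ) * ∏ p ∈ m.primeFactors, ((p - 1 : ℕ) : ℝ) := by ring
  exact le_of_mul_le_mul_right h1 hP0

/-! ### The second bound -/

/-- **Matomäki–Merikoski 2023, Lemma 3.7, second bound**: `∑_{1 ≤ ℓ ≤ L} (ℓ, q) ℓ/φ(ℓ) ≤ e τ(q)² L`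
for `q ≥ 1` ("Similarly, using also `φ(dk) ≥ φ(d)φ(k)` and `∑_{k ≤ K} k/φ(k) ≪ K` we get
`≤ ∑_{d ∣ q} (d²/φ(d)) ∑_{1 ≤ k ≤ L/d} k/φ(k) ≪ ∑_{d ∣ q} Ld/φ(d) … ≤ τ(q)² L`"; here
`∑_{k ≤ K} k/φ(k) ≤ eK` is the tree's `Lichtman2020.sum_div_totient_le` and `d/φ(d) ≤ τ(d) ≤ τ(q)`).
[cite: MatomakiMerikoski2023, Lemma 3.7] -/
theorem MatomakiMerikoski2023_lemma37_ii {q : ℕ} (hq : q ≠ 0) (L : ℕ) :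
    ∑ ℓ ∈ Icc 1 L, (Nat.gcd ℓ q : ℝ) * ((ℓ : ℝ) / Nat.totient ℓ) ≤
      Real.exp 1 * (#q.divisors : ℝ) ^ 2 * L := by
  have hw0 : ∀ ℓ : ℕ, 0 ≤ (ℓ : ℝ) / Nat.totient ℓ := fun ℓ => by positivity
  -- Step 1: `(ℓ, q) ≤ ∑_{e ∣ q, e ∣ ℓ} e` and swap
  have h1 : ∑ ℓ ∈ Icc 1 L, (Nat.gcd ℓ q : ℝ) * ((ℓ : ℝ) / Nat.totient ℓ) ≤
      ∑ e ∈ q.divisors, (e : ℝ) * ∑ ℓ ∈ (Icc 1 L).filter (e ∣ ·), (ℓ : ℝ) / Nat.totient ℓ := by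
    calc ∑ ℓ ∈ Icc 1 L, (Nat.gcd ℓ q : ℝ) * ((ℓ : ℝ) / Nat.totient ℓ)
        ≤ ∑ ℓ ∈ Icc 1 L, (∑ e ∈ q.divisors, if e ∣ ℓ then (e : ℝ) else 0) *
            ((ℓ : ℝ) / Nat.totient ℓ) := by
          refine sum_le_sum fun ℓ _ => mul_le_mul_of_nonneg_right ?_ (hw0 ℓ)
          rw [← sum_filter]
          exact gcd_le_sum_divisors_filter_dvd hq ℓ
      _ = ∑ e ∈ q.divisors, ∑ ℓ ∈ Icc 1 L, (if e ∣ ℓ then (e : ℝ) else 0) *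
            ((ℓ : ℝ) / Nat.totient ℓ) := by rw [sum_comm]; simp only [sum_mul]
      _ = ∑ e ∈ q.divisors, (e : ℝ) * ∑ ℓ ∈ (Icc 1 L).filter (e ∣ ·), (ℓ : ℝ) / Nat.totient ℓ := by
          refine sum_congr rfl fun e _ => ?_
          rw [sum_filter, mul_sum]
          refine sum_congr rfl fun ℓ _ => ?_
          split_ifs <;> simp
  -- Step 2: the inner sums `∑_{ℓ ≤ L, e ∣ ℓ} ℓ/φ(ℓ) ≤ (e/φ(e)) · e · (L/e)` via `ℓ = ek`,
  -- `φ(ek) ≥ φ(e)φ(k)` and `∑_{k ≤ K} k/φ(k) ≤ eK`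
  have h2 : ∀ e ∈ q.divisors, ∑ ℓ ∈ (Icc 1 L).filter (e ∣ ·), (ℓ : ℝ) / Nat.totient ℓ ≤
      ((e : ℝ) / Nat.totient e) * (Real.exp 1 * ((L / e : ℕ) : ℝ)) := by
    intro e he
    have he0 : 0 < e := Nat.pos_of_mem_divisors he
    have hφe : (0 : ℝ) < Nat.totient e := by exact_mod_cast Nat.totient_pos.mpr he0
    -- reindex `ℓ = e k`, `1 ≤ k ≤ L/e`
    have himg : (Icc 1 L).filter (e ∣ ·) = (Icc 1 (L / e)).image (fun k => e * k) := by
      ext ℓ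
      simp only [mem_filter, mem_Icc, mem_image]
      constructor
      · rintro ⟨⟨h1, h2⟩, k, rfl⟩
        refine ⟨k, ⟨?_, ?_⟩, rfl⟩
        · rcases Nat.eq_zero_or_pos k with hk | hk
          · subst hk; omega
          · exact hk
        · exact (Nat.le_div_iff_mul_le he0).mpr (by rw [mul_comm]; exact h2)
      · rintro ⟨k, ⟨hk1, hk2⟩, rfl⟩
        refine ⟨⟨Nat.mul_pos he0 (by omega), ?_⟩, dvd_mul_right e k⟩
        have := (Nat.le_div_iff_mul_le he0).mp hk2
        rw [mul_comm]; exact this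
    rw [himg, sum_image (fun k₁ _ k₂ _ h => Nat.eq_of_mul_eq_mul_left he0 h)]
    calc ∑ k ∈ Icc 1 (L / e), ((e * k : ℕ) : ℝ) / Nat.totient (e * k)
        ≤ ∑ k ∈ Icc 1 (L / e), ((e : ℝ) / Nat.totient e) * ((k : ℝ) / Nat.totient k) := by
          refine sum_le_sum fun k hk => ?_
          have hk0 : 0 < k := (mem_Icc.mp hk).1
          have hφk : (0 : ℝ) < Nat.totient k := by exact_mod_cast Nat.totient_pos.mpr hk0
          have hφek : (0 : ℝ) < Nat.totient (e * k) := by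
            exact_mod_cast Nat.totient_pos.mpr (Nat.mul_pos he0 hk0)
          have hsup : (Nat.totient e : ℝ) * Nat.totient k ≤ Nat.totient (e * k) := by
            exact_mod_cast Nat.totient_super_multiplicative e k
          rw [div_mul_div_comm, Nat.cast_mul, div_le_div_iff₀ hφek (by positivity)]
          have : 0 ≤ (e : ℝ) * k := by positivity
          nlinarith
      _ = ((e : ℝ) / Nat.totient e) * ∑ k ∈ Icc 1 (L / e), (k : ℝ) / Nat.totient k := by
          rw [mul_sum]
      _ ≤ ((e : ℝ) / Nat.totient e) * (Real.exp 1 * ((L / e : ℕ) : ℝ)) :=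
          mul_le_mul_of_nonneg_left (sum_div_totient_le (L / e)) (by positivity)
  -- Step 3: `e · (e/φ(e)) · e' · (L/e) ≤ exp 1 · τ(q) · L` for `e ∣ q`
  have h3 : ∀ e ∈ q.divisors, (e : ℝ) * (((e : ℝ) / Nat.totient e) * (Real.exp 1 * ((L / e : ℕ) : ℝ))) ≤
      Real.exp 1 * (#q.divisors : ℝ) * L := by
    intro e he
    have he0 : 0 < e := Nat.pos_of_mem_divisors he
    have hediv : e ∣ q := Nat.dvd_of_mem_divisors he
    have hτ : (e : ℝ) / Nat.totient e ≤ #q.divisors :=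
      (self_div_totient_le_card_divisors' he0.ne').trans
        (by exact_mod_cast card_le_card (Nat.divisors_subset_of_dvd hq hediv))
    have hL : (e : ℝ) * ((L / e : ℕ) : ℝ) ≤ L := by exact_mod_cast Nat.mul_div_le L e
    have h0 : 0 ≤ (e : ℝ) * ((L / e : ℕ) : ℝ) := by positivity
    calc (e : ℝ) * (((e : ℝ) / Nat.totient e) * (Real.exp 1 * ((L / e : ℕ) : ℝ)))
        = Real.exp 1 * ((e : ℝ) / Nat.totient e) * ((e : ℝ) * ((L / e : ℕ) : ℝ)) := by ring
      _ ≤ Real.exp 1 * (#q.divisors : ℝ) * L := by gcongr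
  calc ∑ ℓ ∈ Icc 1 L, (Nat.gcd ℓ q : ℝ) * ((ℓ : ℝ) / Nat.totient ℓ)
      ≤ ∑ e ∈ q.divisors, (e : ℝ) * ∑ ℓ ∈ (Icc 1 L).filter (e ∣ ·), (ℓ : ℝ) / Nat.totient ℓ := h1
    _ ≤ ∑ e ∈ q.divisors, (e : ℝ) * (((e : ℝ) / Nat.totient e) * (Real.exp 1 * ((L / e : ℕ) : ℝ))) :=
        sum_le_sum fun e he => mul_le_mul_of_nonneg_left (h2 e he) (Nat.cast_nonneg e)
    _ ≤ ∑ _e ∈ q.divisors, Real.exp 1 * (#q.divisors : ℝ) * L := sum_le_sum h3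
    _ = Real.exp 1 * (#q.divisors : ℝ) ^ 2 * L := by rw [sum_const, nsmul_eq_mul]; ring

end Literature.NumberTheory.LFunctions.MatomakiMerikoski
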